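import Mathlib.Analysis.Matrix.PosDef
import Mathlib.Topology.Instances.Matrix
import Mathlib.Topology.Order.IntermediateValue
import Literature.MathematicalPhysics.QuantumLattice.GrassmannIntegralWilsonProofs
import HarnessLib

/-!
# Barrier (companion of `WilsonDeterminantSign`): the signed Wilson weight changes sign only
# through real modes — the mass-SPLIT two-flavour weight `det D_W(m_u) det D_W(m_d)` is not
# positive either, and positivity is restored exactly by degenerate pairs or a twisted mass

Barrier catalogue `Literature/Barriers/QuantumFields/` (D-0021), summit `QuantumFields`,
sub-problem `ChiralRegime` = `QCDChiralOf 2 ∧ QCDChiralOf 3` (draft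
`docs/m5/drafts/QuantumFields.ChiralRegime.Statement.lean`), which quantifies over EVERY tuple of
positive renormalised masses — "all mass splittings", so `QCDChiralOf 2` includes `m_u ≠ m_d` —
with the honest signed weight `e^{-S_g} Π_f det D_W(U, m_f(k), 1)` (`qcdTorusExpect`).

**Nearest prior art in the catalogue and the delta.** `Literature.Barriers.QuantumFields.WilsonDeterminantSign`
(landed) proves the parity formula `sign det D_W = (−1)^Q` through the Hermitian operator
`γ₅D_W` and records the barrier for an ODD number of DEGENERATE Wilson flavours, listing "even
numbers of degenerate flavours … so the `N_f = 2` half of `ChiralRegime` is untouched" among the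
evasions. This file adds what that entry does not cover: (1) the sign change is located on the
MASS axis — a negative single-flavour determinant at bare mass `m` forces an exact zero mode of
`D_W` at some heavier bare mass `m + s`, i.e. a negative REAL eigenvalue of `D_W` (the `n_neg` of
Mohler–Schaefer), by the intermediate value theorem on the real polynomial `t ↦ det D_W(m + t)`;
(2) consequently the two-flavour weight with SPLIT masses `m₁ < m₂` is negative only if `D_W` has
a real mode strictly between the two bare masses — and such weights do go negative, so the
`N_f = 2` half of `ChiralRegime` with `m_u ≠ m_d` is inside the technique class's failure region,
not untouched; (3) the two restorations of positivity used in practice, PROVED configuration-wise: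
degenerate pairs `det² ≥ 0` and the twisted-mass doublet `det((γ₅D_W)² + μ²) > 0` for `μ ≠ 0`;
(4) the dynamical `N_f = 2+1` evidence with frequencies (Mohler–Schaefer 2020).

## The printed result (Mohler–Schaefer, Phys. Rev. D 102 (2020) 074506)

§1: "In general, chiral symmetry together with `γ₅`-Hermiticity guarantees the positivity of the
fermion determinant for each flavor, but for Wilson fermions the explicit breaking of chiral
symmetry makes negative values possible. Thus, in the absence of further restrictions, there are
regions of configuration space, where the fermion determinant is negative"; "among the major
discretizations, only Wilson-type fermions are affected." §2: `Z = ∫[dU] det{D(m_ud)}² det{D(m_s)} e^{-S_g[U]}`;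
"Because of the `γ₅`-Hermiticity … the determinant is real, and each eigenvalue `λ` … is either
real or comes in a complex conjugate pair … negative values of the fermion determinant appear if
there is an odd number `n_neg` of negative real eigenvalues of `D`"; "the determinants themselves
are not suitable weights for the Monte Carlo evaluation of the path integral, because they are
not positive", cured by the sign reweighting `W_s = det D_s/|det D_s| = (−1)^{n_neg}`,
`⟨A⟩ = ⟨AW_s⟩₊/⟨W_s⟩₊` (§2.1); "changing `n_neg` by one unit can only be achieved by going through
configurations with a zero eigenvalue of `D` … Configuration space is therefore divided into
sectors of even and odd `n_neg`, where `n_neg` is in general different for light and strange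
quarks" (§2.2); twisted-mass reweighting of the light doublet,
`det{D̂†D̂} → det{[D̂†D̂ + μ₀²]²/(D̂†D̂ + 2μ₀²)}` (§2.3); "Since `D(m) = D(0) + m`, for increasing
quark mass the negative real eigenvalues will first decrease in magnitude before going through
zero" (§4). §4.2 (CLS `N_f = 2+1`, `a ≈ 0.09 … 0.04` fm): negative strange determinants "of
roughly two percent at `β = 3.4` and `β = 3.46`, on around `0.3%` of the configurations at
`β = 3.55` and … `∼ 0.05%` at `β = 3.7`. As one would expect, negative real eigenvalues quickly
become unlikely as the continuum limit is approached." §5.3: "Negative real eigenvalues of the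
Dirac operator at the strange mass are also negative at the light-quark mass (if chosen below the
strange's mass-value). While the degeneracy of the two quark masses makes the product of the two
determinants positive, the negative eigenvalues can still introduce large autocorrelations".
Montvay–Münster 1994 §5.1.2 (5.15)–(5.16): `γ₅`-Hermiticity and reality (tree:
`wilsonDirac_gammaFive_hermitian_holds`, `fermionDet_wilsonDirac_im_holds`).

## What is vendored — and PROVED

For a general `Γ`-Hermitian matrix (`WilsonSign.IsGammaHermitian Γ D`: `ΓDΓ = Dᴴ`, `Γ² = 1`)
and then for the tree's `wilsonDirac ρ U m r` (any `L`, `N`, `G`, unitary `ρ`, real `m`, `r`;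
`wilsonDirac_add_mass`: `D_W(m + s) = D_W(m) + s·1`): reality of `det`; the zero-mode theorem
(`exists_neg_real_eigenvalue_of_det_neg`: `Re det D < 0 ⇒ det(D + s) = 0` for some `s > 0`, via
continuity, `det(D + S) = S^n det(1 + D/S) > 0` for large `S`, and the intermediate value
theorem); the mass-split theorem (`exists_zero_between_of_det_mul_neg`: `Re(det(D+m₁)det(D+m₂)) < 0`,
`m₁ < m₂` ⇒ `det(D + t) = 0` for some `t ∈ (m₁, m₂)`); `det² ≥ 0`; the twisted-mass identities
`det(Q + iμ)det(Q − iμ) = det(Q² + μ²)` and `det(Q² + μ²) > 0` for Hermitian `Q`, `μ ≠ 0`. The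
record `WilsonDeterminantMassSplitting` is their conjunction for `wilsonDirac` (proved,
`WilsonDeterminantMassSplitting_holds`). NOT formalised: the existence and frequency of gauge
fields with odd `n_neg` (numerical, §4.2), and the converse parity statements.

## References

[MohlerSchaefer2020] [MontvayMunster1994] and the landed `Literature.Barriers.QuantumFields.WilsonDeterminantSign`.
-/
noncomputable section

open Matrix Complex Filter Topology
open scoped ComplexOrder
open Literature.MathematicalPhysics.QuantumLattice

namespace Literature.Barriers.QuantumFields

namespace WilsonSign

variable {n : Type*} [Fintype n] [DecidableEq n]

/-- **`Γ`-Hermiticity** with an involutive `Γ`: `Γ D Γ = Dᴴ` and `Γ² = 1` — the property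
`γ₅Dγ₅ = D†` of the Wilson–Dirac operator (Montvay–Münster (5.15); Mohler–Schaefer §2), which
survives the explicit breaking of chiral symmetry by the Wilson term.
[cite: MohlerSchaefer2020, §2] [cite: MontvayMunster1994, §5.1.2 (5.15)] -/
structure IsGammaHermitian (Γ D : Matrix n n ℂ) : Prop where
  conj_eq : Γ * D * Γ = Dᴴ
  sq_eq_one : Γ * Γ = 1

/-- `Γ`-Hermiticity makes the determinant real: `conj det D = det Dᴴ = det(ΓDΓ) = det D`
("the determinant is real, `det{D} = (det{D})^*`"). [cite: MohlerSchaefer2020, §2] [cite: MontvayMunster1994, §5.1.2 (5.16)] -/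
theorem IsGammaHermitian.star_det {Γ D : Matrix n n ℂ} (h : IsGammaHermitian Γ D) :
    star D.det = D.det := by
  rw [← det_conjTranspose, ← h.conj_eq, det_mul, det_mul, mul_comm (det Γ) (det D), mul_assoc,
    ← det_mul, h.sq_eq_one, det_one, mul_one]

/-- The imaginary part of the determinant of a `Γ`-Hermitian matrix vanishes. [cite: MohlerSchaefer2020, §2] -/
theorem IsGammaHermitian.det_im {Γ D : Matrix n n ℂ} (h : IsGammaHermitian Γ D) : D.det.im = 0 :=
  Complex.conj_eq_iff_im.1 h.star_det

/-- A real mass shift preserves `Γ`-Hermiticity (`D(m) = D(0) + m`). [cite: MohlerSchaefer2020, §4 ("D(m) = D(0) + m")] -/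
theorem IsGammaHermitian.add_real {Γ D : Matrix n n ℂ} (h : IsGammaHermitian Γ D) (t : ℝ) :
    IsGammaHermitian Γ (D + (t : ℂ) • (1 : Matrix n n ℂ)) where
  conj_eq := by
    rw [mul_add, add_mul, h.conj_eq, Matrix.mul_smul, Matrix.smul_mul, mul_one, h.sq_eq_one,
      conjTranspose_add, conjTranspose_smul, conjTranspose_one]
    simp
  sq_eq_one := h.sq_eq_one

/-- `t ↦ det(D + t·1)` is continuous (a polynomial in `t`). [folklore] -/
theorem continuous_det_add_real (D : Matrix n n ℂ) :
    Continuous fun t : ℝ => (D + (t : ℂ) • (1 : Matrix n n ℂ)).det :=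
  Continuous.matrix_det (continuous_const.add ((Complex.continuous_ofReal).smul continuous_const))

/-- For a large enough real shift `S > 0`, `det(D + S)` has positive real part
(`det(D + S) = S^n det(1 + D/S)` and `det(1 + D/S) → 1`). [folklore] -/
theorem exists_re_det_add_pos (D : Matrix n n ℂ) :
    ∃ S : ℝ, 0 < S ∧ 0 < (D + (S : ℂ) • (1 : Matrix n n ℂ)).det.re := by
  have hc : Continuous fun s : ℝ => ((1 : Matrix n n ℂ) + (s : ℂ) • D).det :=
    Continuous.matrix_det (continuous_const.add ((Complex.continuous_ofReal).smul continuous_const))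
  have h0 : ((1 : Matrix n n ℂ) + ((0 : ℝ) : ℂ) • D).det = 1 := by simp
  have hre : ContinuousAt (fun s : ℝ => ((1 : Matrix n n ℂ) + (s : ℂ) • D).det.re) 0 :=
    (Complex.continuous_re.continuousAt).comp hc.continuousAt
  have hev : ∀ᶠ (s : ℝ) in 𝓝 0, (1 / 2 : ℝ) < ((1 : Matrix n n ℂ) + ((s : ℝ) : ℂ) • D).det.re := by
    refine hre.eventually (lt_mem_nhds ?_)
    norm_num
  obtain ⟨δ, hδ, hball⟩ := Metric.eventually_nhds_iff.1 hev
  refine ⟨2 / δ, by positivity, ?_⟩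
  have hs : dist (δ / 2) (0 : ℝ) < δ := by
    rw [Real.dist_eq, sub_zero, abs_of_pos (by positivity)]; linarith
  have hpos := hball hs
  have hfac : D + ((2 / δ : ℝ) : ℂ) • (1 : Matrix n n ℂ) =
      ((2 / δ : ℝ) : ℂ) • ((1 : Matrix n n ℂ) + ((δ / 2 : ℝ) : ℂ) • D) := by
    rw [smul_add, smul_smul, ← Complex.ofReal_mul]
    have : (2 / δ * (δ / 2) : ℝ) = 1 := by field_simp
    rw [this, Complex.ofReal_one, one_smul, add_comm]
  rw [hfac, det_smul, ← Complex.ofReal_pow, Complex.re_ofReal_mul]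
  exact mul_pos (by positivity) (lt_trans (by norm_num) hpos)

/-- **Sign changes only through zero modes (sectors).** A `Γ`-Hermitian matrix with negative
determinant has a NEGATIVE REAL eigenvalue: `det(D + s) = 0` for some `s > 0`. (The printed
form: `det D < 0` iff the number `n_neg` of negative real eigenvalues is odd; here the direction
`det D < 0 ⇒ n_neg ≥ 1`, by the intermediate value theorem along the real, continuous function
`t ↦ det(D + t)`, negative at `t = 0`, positive for large `t`.) Hence "changing `n_neg` by one
unit can only be achieved by going through configurations with a zero eigenvalue of `D`".
[cite: MohlerSchaefer2020, §2 and §2.2] -/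
theorem IsGammaHermitian.exists_neg_real_eigenvalue_of_det_neg {Γ D : Matrix n n ℂ}
    (h : IsGammaHermitian Γ D) (hneg : D.det.re < 0) :
    ∃ s : ℝ, 0 < s ∧ (D + (s : ℂ) • (1 : Matrix n n ℂ)).det = 0 := by
  obtain ⟨S, hS, hSpos⟩ := exists_re_det_add_pos D
  set g : ℝ → ℝ := fun t => (D + (t : ℂ) • (1 : Matrix n n ℂ)).det.re with hg
  have hgc : Continuous g := Complex.continuous_re.comp (continuous_det_add_real D)
  have hg0 : g 0 < 0 := by simp [hg, hneg]
  have hmem : (0 : ℝ) ∈ Set.Icc (g 0) (g S) := ⟨hg0.le, hSpos.le⟩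
  obtain ⟨s, hs, hs0⟩ := intermediate_value_Icc hS.le hgc.continuousOn hmem
  have hs_ne : s ≠ 0 := by rintro rfl; exact hg0.ne hs0
  refine ⟨s, lt_of_le_of_ne hs.1 (Ne.symm hs_ne), ?_⟩
  apply Complex.ext
  · simpa [hg] using hs0
  · simpa using (h.add_real s).det_im

/-- **The mass-split two-flavour weight.** For a `Γ`-Hermitian `D` (think `D = D_W(0)`) and bare
masses `m₁ < m₂`, if the two-flavour weight `det(D + m₁)·det(D + m₂)` is negative then
`det(D + t) = 0` for some `t` strictly between `m₁` and `m₂`: `D` has a real eigenvalue `−t`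
with `−m₂ < −t < −m₁` ("Negative real eigenvalues of the Dirac operator at the strange mass are
also negative at the light-quark mass … the degeneracy of the two quark masses makes the product
of the two determinants positive" — with SPLIT masses only the modes lying between the two masses
flip the sign of the product). Intermediate value theorem on the real continuous
`t ↦ det(D + t)`. [cite: MohlerSchaefer2020, §5.3 and §4 ("D(m) = D(0) + m")] -/
theorem IsGammaHermitian.exists_zero_between_of_det_mul_neg {Γ D : Matrix n n ℂ}
    (h : IsGammaHermitian Γ D) {m₁ m₂ : ℝ} (hm : m₁ < m₂)
    (hneg : ((D + (m₁ : ℂ) • (1 : Matrix n n ℂ)).det *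
      (D + (m₂ : ℂ) • (1 : Matrix n n ℂ)).det).re < 0) :
    ∃ t ∈ Set.Ioo m₁ m₂, (D + (t : ℂ) • (1 : Matrix n n ℂ)).det = 0 := by
  set g : ℝ → ℝ := fun t => (D + (t : ℂ) • (1 : Matrix n n ℂ)).det.re with hg
  have hgc : Continuous g := Complex.continuous_re.comp (continuous_det_add_real D)
  have him : ∀ t : ℝ, (D + (t : ℂ) • (1 : Matrix n n ℂ)).det.im = 0 :=
    fun t => (h.add_real t).det_im
  have hprod : g m₁ * g m₂ < 0 := by
    have := hneg
    rw [Complex.mul_re, him m₁, him m₂, mul_zero, sub_zero] at this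
    exact this
  have key : ∃ t ∈ Set.Ioo m₁ m₂, g t = 0 := by
    rcases lt_or_gt_of_ne (show g m₁ ≠ 0 from fun h0 => by simp [h0] at hprod) with h1 | h1
    · have h2 : 0 < g m₂ := by
        by_contra hle; push Not at hle
        exact absurd hprod (not_lt.2 (mul_nonneg_of_nonpos_of_nonpos h1.le hle))
      exact intermediate_value_Ioo hm.le hgc.continuousOn ⟨h1, h2⟩
    · have h2 : g m₂ < 0 := by
        by_contra hle; push Not at hle
        exact absurd hprod (not_lt.2 (mul_nonneg h1.le hle))
      exact intermediate_value_Ioo' hm.le hgc.continuousOn ⟨h2, h1⟩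
  obtain ⟨t, ht, ht0⟩ := key
  refine ⟨t, ht, Complex.ext ?_ ?_⟩
  · simpa [hg] using ht0
  · simpa using him t

/-- **Evasion 1 (two mass-degenerate flavours).** The two-flavour weight `(det D)²` is real and
non-negative ("the degeneracy of the two quark masses makes the product of the two determinants
positive"). [cite: MohlerSchaefer2020, §5.3 and §2 (det{D(m_ud)}²)] -/
theorem IsGammaHermitian.det_sq_nonneg {Γ D : Matrix n n ℂ} (h : IsGammaHermitian Γ D) :
    0 ≤ (D.det ^ 2).re ∧ (D.det ^ 2).im = 0 := by
  have him := h.det_im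
  refine ⟨?_, ?_⟩
  · rw [pow_two, Complex.mul_re, him, mul_zero, sub_zero]; exact mul_self_nonneg _
  · rw [pow_two, Complex.mul_im, him]; simp

/-- The twisted-mass doublet factorises: `det(Q + iμ) det(Q − iμ) = det(Q² + μ²)`. [folklore] -/
theorem det_twisted_eq (Q : Matrix n n ℂ) (μ : ℝ) :
    (Q + ((μ : ℂ) * I) • (1 : Matrix n n ℂ)).det * (Q - ((μ : ℂ) * I) • (1 : Matrix n n ℂ)).det =
      (Q * Q + ((μ ^ 2 : ℝ) : ℂ) • (1 : Matrix n n ℂ)).det := by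
  rw [← det_mul]
  congr 1
  have hI : (μ : ℂ) * I * ((μ : ℂ) * I) = -((μ ^ 2 : ℝ) : ℂ) := by
    push_cast; ring_nf; rw [Complex.I_sq]; ring
  rw [add_mul, mul_sub, mul_sub]
  simp only [Matrix.mul_smul, mul_one, Matrix.smul_mul, one_mul, smul_smul, hI, neg_smul]
  abel

/-- **Evasion 2 (twisted mass).** For Hermitian `Q` (the Hermitian Wilson operator `γ₅D_W`) and
`μ ≠ 0`, `det(Q² + μ²) > 0`: the twisted-mass doublet weight is strictly positive on EVERY
configuration (no zero modes, no sectors) — the regularisation used for the light quarks.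
[cite: MohlerSchaefer2020, §2.3 (twisted-mass reweighting)] -/
theorem det_twisted_pos {Q : Matrix n n ℂ} (hQ : Q.IsHermitian) {μ : ℝ} (hμ : μ ≠ 0) :
    0 < (Q * Q + ((μ ^ 2 : ℝ) : ℂ) • (1 : Matrix n n ℂ)).det := by
  have h1 : (Q * Q).PosSemidef := by
    have := Matrix.posSemidef_conjTranspose_mul_self Q
    rwa [hQ.eq] at this
  have hμ2 : (0 : ℂ) < ((μ ^ 2 : ℝ) : ℂ) := by
    rw [Complex.zero_lt_real]
    positivity
  have h2 : (((μ ^ 2 : ℝ) : ℂ) • (1 : Matrix n n ℂ)).PosDef := by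
    rw [smul_one_eq_diagonal]
    exact PosDef.diagonal fun _ => hμ2
  exact Matrix.PosDef.det_pos (Matrix.PosDef.posSemidef_add h1 h2)

end WilsonSign

open WilsonSign

/-! ### The Wilson–Dirac operator of the tree -/

section Wilson

variable {L N : ℕ} [NeZero L] {G : Type*} [Group G] (ρ : G →* Matrix (Fin N) (Fin N) ℂ)

omit [NeZero L] in
/-- The bare mass enters additively: `D_W(m + s) = D_W(m) + s·1` ("`D(m) = D(0) + m`").
[cite: MohlerSchaefer2020, §4] -/
theorem wilsonDirac_add_mass (U : Literature.MathematicalPhysics.QuantumFieldTheory.GaugeConfig 4 L G)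
    (m s r : ℝ) : wilsonDirac ρ U (m + s) r = wilsonDirac ρ U m r + (s : ℂ) • 1 := by
  ext p q
  rw [Matrix.add_apply, Matrix.smul_apply, Matrix.one_apply]
  simp only [wilsonDirac, Matrix.of_apply]
  by_cases h : p = q
  · rw [if_pos h, if_pos h, if_pos h, smul_eq_mul]; push_cast; ring
  · rw [if_neg h, if_neg h, if_neg h, smul_zero, add_zero]

/-- The tree's gauge-covariant Wilson–Dirac operator is `γ₅`-Hermitian in the sense of
`IsGammaHermitian` with `Γ = 1 ⊗ 1 ⊗ γ₅`, for every unitary representation `ρ`, gauge field `U`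
and real `m`, `r` (from the landed `wilsonDirac_gammaFive_hermitian_holds` and
`spinorLift_gammaFive_mul_self`). [cite: MontvayMunster1994, §5.1.2 (5.15)] -/
theorem isGammaHermitian_wilsonDirac (hρ : ∀ g, ρ g ∈ Matrix.unitaryGroup (Fin N) ℂ)
    (U : Literature.MathematicalPhysics.QuantumFieldTheory.GaugeConfig 4 L G) (m r : ℝ) :
    IsGammaHermitian (spinorLift gammaFive) (wilsonDirac ρ U m r) :=
  ⟨wilsonDirac_gammaFive_hermitian_holds ρ hρ U m r, spinorLift_gammaFive_mul_self⟩

/-- The Hermitian Wilson operator `Q = γ₅ D_W` is Hermitian. [cite: MohlerSchaefer2020, §4 ("the Hermitian system Q̂ = γ₅D̂")] -/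
theorem isHermitian_gammaFive_mul_wilsonDirac (hρ : ∀ g, ρ g ∈ Matrix.unitaryGroup (Fin N) ℂ)
    (U : Literature.MathematicalPhysics.QuantumFieldTheory.GaugeConfig 4 L G) (m r : ℝ) :
    (spinorLift gammaFive * wilsonDirac ρ U m r).IsHermitian := by
  have hconj := wilsonDirac_gammaFive_hermitian_holds ρ hρ U m r
  have hsq := spinorLift_gammaFive_mul_self (L := L) (N := N)
  have hΓ : (spinorLift (L := L) (N := N) gammaFive)ᴴ = spinorLift gammaFive := by
    rw [spinorLift_gammaFive_eq_diagonal, diagonal_conjTranspose]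
    congr 1
    funext p
    obtain ⟨x, a, α⟩ := p
    fin_cases α <;> simp
  unfold Matrix.IsHermitian
  rw [conjTranspose_mul, ← hconj, hΓ, Matrix.mul_assoc, Matrix.mul_assoc, hsq, Matrix.mul_one]

end Wilson

/-- **Barrier record (companion of `WilsonDeterminantSign`): sign changes of the Wilson weight
sit at real modes on the mass axis; the mass-split two-flavour weight is sign-indefinite too;
positivity is restored exactly by degenerate pairs or a twisted mass — Mohler–Schaefer 2020.**
For the tree's Wilson–Dirac operator `D(m) = wilsonDirac ρ U m r` (any torus side `L ≥ 1`, colour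
number `N`, gauge group `G`, unitary `ρ`, gauge field `U`, real `m`, `r`): (i) if
`Re det D(m) < 0` then `det D(m + s) = 0` for some `s > 0` — a negative single-flavour weight
forces an exact zero mode at a heavier bare mass, i.e. a negative REAL eigenvalue `−s` of `D(m)`
(`n_neg ≥ 1`); (ii) for bare masses `m₁ < m₂`, if the two-flavour weight `det D(m₁)·det D(m₂)`
has negative real part then `det D(t) = 0` for some `t ∈ (m₁, m₂)` — the SPLIT-mass weight can
be negative only through real modes lying strictly between the two masses; (iii) the degenerate
weight `(det D(m))²` is real and `≥ 0`; (iv) the twisted-mass doublet weight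
`det((γ₅D(m))² + μ²)` is `> 0` for every `μ ≠ 0`. Proved below (`WilsonDeterminantMassSplitting_holds`).
What makes (i)–(ii) a barrier is the printed occurrence of such real modes in the light-quark
bare-mass window: negative strange determinants on `∼ 2%` (`β = 3.4`) … `∼ 0.05%` (`β = 3.7`) of
`N_f = 2+1` configurations, and "Negative real eigenvalues … at the strange mass are also negative
at the light-quark mass".
[cite: MohlerSchaefer2020, §2, §2.2, §4, §4.2, §5.3] [cite: MontvayMunster1994, §5.1.2 (5.15)–(5.16)]

BARRIER
technique_class: positive-gauge-measure, probabilistic-fermion-weight, correlation-inequalities-with-fermions, pointwise-inequality-arguments-integrated-against-det (Vafa–Witten/Weingarten type), importance-sampling — the class of the landed `Literature.Barriers.QuantumFields.WilsonDeterminantSign`, here for flavour contents that are NOT unions of mass-degenerate pairs: an odd flavour (`N_f = 3 = 2+1`) OR two flavours with `m₁ ≠ m₂` [cite: MohlerSchaefer2020, §1–§2, §5.3]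
blocks: extending the evasion "even numbers of degenerate flavours" of `WilsonDeterminantSign` to the mass-SPLIT `N_f = 2` half of `ChiralRegime`/`QCDChiralOf 2` ("for every tuple of positive renormalised quark masses … all mass splittings", draft docs/m5/drafts/QuantumFields.ChiralRegime.Statement.lean; likewise the conjunct `Literature.MathematicalPhysics.QuantumFieldTheory.QCD`): with `m_u ≠ m_d` the honest weight `det D_W(m_u(k)) det D_W(m_d(k))` in `qcdTorusExpect` is real but negative exactly on gauge fields carrying an odd number of real modes of `D_W` between the two bare masses ((ii) gives the direction "negative ⇒ such a mode exists"), and such modes are reported in the light-quark window [cite: MohlerSchaefer2020, §5.3, §4.2]; so positivity-based arguments (`|⟨A⟩| ≤ sup|A|`, Jensen/FKG/Griffiths-type and Vafa–Witten/Weingarten-type "pointwise in `U` ⇒ for the theory" inequalities, probabilistic couplings, importance sampling with weight `det`) are unavailable AS STATED for every mass tuple off the degenerate locus, not only for odd `N_f`; it does NOT block the degenerate locus ((iii)), twisted-mass doublets ((iv)), `|det|`-with-sign-reweighting identities, or continuum statements in which odd-`n_neg` fields are shown negligible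
because: `γ₅`-Hermiticity gives reality and conjugate pairing only, so `sign det D = (−1)^{n_neg}`, `n_neg` = number of negative real eigenvalues [cite: MohlerSchaefer2020, §2] (parity formula via `γ₅D_W`: `WilsonDeterminantSign`); the bare mass shifts the spectrum rigidly, `D(m) = D(0) + m` (`wilsonDirac_add_mass`), so along the mass axis a sign change of the real polynomial `t ↦ det D(t)` is a zero, i.e. a real eigenvalue crossing — "changing `n_neg` by one unit can only be achieved by going through configurations with a zero eigenvalue of `D`", sectors of even/odd `n_neg`, "in general different for light and strange quarks" [cite: MohlerSchaefer2020, §2.2, §4]; for two masses the product flips sign once per real mode in `(−m₂, −m₁)` ((ii), intermediate value theorem), while modes below both masses flip both factors [cite: MohlerSchaefer2020, §5.3]; such modes occur on sampled `N_f = 2+1` fields at `a ≈ 0.09–0.04` fm [cite: MohlerSchaefer2020, §4.2]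
evasions_known: degenerate pairs, `det² ≥ 0` ((iii)) [cite: MohlerSchaefer2020, §5.3]; twisted-mass doublet `det(Q + iμ)det(Q − iμ) = det(Q² + μ²) > 0` on EVERY configuration, no sectors ((iv), `det_twisted_eq`, `det_twisted_pos`), used as simulated weight with exact reweighting [cite: MohlerSchaefer2020, §2.3]; carry the exact sign `W = (−1)^{n_neg}` as a reweighting factor, `⟨A⟩ = ⟨AW⟩₊/⟨W⟩₊` — a signed-measure identity, not a positivity [cite: MohlerSchaefer2020, §2.1, §5.4]; chirally symmetric discretisations ("only Wilson-type fermions are affected") [cite: MohlerSchaefer2020, §1]; finer lattices, where odd `n_neg` becomes rare (`2% → 0.05%`) [cite: MohlerSchaefer2020, §4.2]; see also the evasions of `WilsonDeterminantSign` (subcritical `κ < 1/8`, overlap kernels)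
scope_caveats: (a) PROVED: (i)–(iv) for the tree's `wilsonDirac` with any unitary `ρ` (and abstractly for any `Γ`-Hermitian matrix); only the directions "negative ⇒ a real mode exists (between the masses)" are formalised, not the converse parity counts with algebraic multiplicities; (b) NOT formalised: that `SU(3)` gauge fields with real modes of `D_W` inside the relevant bare-mass window exist at given `(β, κ)`, or their measure — the evidence is numerical, for `N_f = 2+1` non-perturbatively `O(a)`-improved Wilson fermions (clover term; `γ₅`-Hermiticity and the mechanism unchanged, frequencies action-dependent) with Lüscher–Weisz gauge action and twisted-mass/RHMC-regularised sampling [cite: MohlerSchaefer2020, §2, §4.2], and the authors weigh algorithmic explanations before adopting "a feature of the action" as working hypothesis [cite: MohlerSchaefer2020, §5]; (c) for split LIGHT masses `m_u ≠ m_d` the source prints only that strange-mass negative modes are also negative at the lighter mass and that degeneracy restores positivity [cite: MohlerSchaefer2020, §5.3]; the statement "the split two-flavour weight is negative on fields with an odd number of real modes between `−m_d` and `−m_u`" is the elementary consequence formalised here in one direction, not a printed measurement of its frequency; (d) finite lattice spacing only; nothing is claimed about continuum limits of sign-reweighted expectations, which is what the summit statements quantify over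
status: established — linear algebra [cite: MontvayMunster1994, §5.1.2 (5.15)–(5.16)] (tree: `wilsonDirac_gammaFive_hermitian_holds`, `fermionDet_wilsonDirac_im_holds`; parity: `WilsonDeterminantSign`) and proved below; occurrence of real modes / negative determinants in the light window: numerical [cite: MohlerSchaefer2020, §4.2, §5.3]
-/
def WilsonDeterminantMassSplitting : Prop :=
  ∀ (L N : ℕ) [NeZero L] (G : Type) [Group G] (ρ : G →* Matrix (Fin N) (Fin N) ℂ),
    (∀ g, ρ g ∈ Matrix.unitaryGroup (Fin N) ℂ) →
    ∀ (U : Literature.MathematicalPhysics.QuantumFieldTheory.GaugeConfig 4 L G) (m r : ℝ),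
      ((wilsonDirac ρ U m r).det.re < 0 →
        ∃ s : ℝ, 0 < s ∧ (wilsonDirac ρ U (m + s) r).det = 0) ∧
      (∀ m₂ : ℝ, m < m₂ →
        ((wilsonDirac ρ U m r).det * (wilsonDirac ρ U m₂ r).det).re < 0 →
          ∃ t ∈ Set.Ioo m m₂, (wilsonDirac ρ U t r).det = 0) ∧
      (0 ≤ ((wilsonDirac ρ U m r).det ^ 2).re ∧ ((wilsonDirac ρ U m r).det ^ 2).im = 0) ∧
      ∀ μ : ℝ, μ ≠ 0 →
        0 < (spinorLift gammaFive * wilsonDirac ρ U m r * (spinorLift gammaFive * wilsonDirac ρ U m r) +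
          ((μ ^ 2 : ℝ) : ℂ) • (1 : Matrix _ _ ℂ)).det

/-- **Proof of the record** from the `Γ`-Hermitian linear algebra above, `wilsonDirac_add_mass`
and the landed `γ₅`-Hermiticity of `wilsonDirac`. [cite: MontvayMunster1994, §5.1.2 (5.15)–(5.16)] [cite: MohlerSchaefer2020, §2, §5.3] -/
theorem WilsonDeterminantMassSplitting_holds : WilsonDeterminantMassSplitting := by
  intro L N _ G _ ρ hρ U m r
  have h := isGammaHermitian_wilsonDirac ρ hρ U m r
  refine ⟨fun hneg => ?_, fun m₂ hm hneg => ?_, h.det_sq_nonneg,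
    fun μ hμ => det_twisted_pos (isHermitian_gammaFive_mul_wilsonDirac ρ hρ U m r) hμ⟩
  · obtain ⟨s, hs, hdet⟩ := h.exists_neg_real_eigenvalue_of_det_neg hneg
    exact ⟨s, hs, by rw [wilsonDirac_add_mass]; exact hdet⟩
  · -- rewrite both determinants around `D(m)`: `D(m₂) = D(m) + (m₂ - m)`, `D(m) = D(m) + 0`
    have h0 : wilsonDirac ρ U m r = wilsonDirac ρ U m r + ((0 : ℝ) : ℂ) • 1 := by simp
    have h2 : wilsonDirac ρ U m₂ r = wilsonDirac ρ U m r + ((m₂ - m : ℝ) : ℂ) • 1 := by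
      rw [← wilsonDirac_add_mass]; congr 1; ring
    rw [h2] at hneg
    conv at hneg => rw [h0]; lhs; arg 1; arg 2; rw [← h0]
    obtain ⟨t, ht, hdet⟩ :=
      h.exists_zero_between_of_det_mul_neg (m₁ := 0) (m₂ := m₂ - m) (by linarith) (by simpa using hneg)
    refine ⟨m + t, ⟨by linarith [ht.1], by linarith [ht.2]⟩, ?_⟩
    rw [wilsonDirac_add_mass]
    exact hdet

end Literature.Barriers.QuantumFields

end
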